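import Summits.Ventures.CertifiedArithmetic.LowPrec.DoubleRoundingProductTwoGrid
import Summits.Ventures.CertifiedArithmetic.LowPrec.DoubleRoundingProductSameQuantumStripLaw
import Summits.Ventures.CertifiedArithmetic.LowPrec.DoubleRoundingProductMatrix

/-!
# Double rounding of products at a finer register quantum: the three zones of the two-grid window

HONEST FRAMING (venture CertifiedArithmetic / cell `pub-lowprec`): certified error envelopes and
provably optimal rounding/accumulation schemes for low-precision formats under stated cost models;
every table by two implementations; no hardware or vendor claims.

Setting: target `φ` (`m = m_φ ≥ 1`, quantum `q`), register `ψ` with quantum `q_ψ = q / 2^d`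
(`L_φ = L_ψ + d`) and `m_ψ ≥ 1`.  The two-grid window (`DoubleRoundingProductTwoGrid.lean`) is
instantiated on the three kinds of cell of `φ` a positive rational can fall in below `maxRat φ`:
§1 a NORMAL cell `[c, c+1]·2^(k+1) q` (`2^m ≤ c < 2^(m+1)`; `fl_φ` by the gap lemmas; the tie
flag is `w + 1 ≤ k + d` where `2^w q_ψ` is the register grid on the cell); §2 a LOW cell
`[c, c+1]·q`, `1 ≤ c < 2^(m+1)` (gradual underflow of `φ`; `fl_φ` by
`toRat_roundNE_natMul_add_small` and the half-integer lemmas; tie flag `w + 2 ≤ d`); §3 the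
BOTTOM cell `[0, q]` (`fl_φ` is `0` up to `q/2` inclusive; no parity, the tie always counts).  In
each, `x = B + r·s` with `s` the unit of the last bit of the product and `2^g s` half the register
grid; a slip forces the window `|r - half| ≤ 2^g` on the side the parity of `c` dictates.  These
are the pointwise lemmas the record-generic positive law on the fine strip consumes
(`DoubleRoundingProductStripFineLaw.lean`).
PLACEMENT — KNOWN: slips happen only through midpoints of the target
([MartinDorelMelquiondMuller2013, Property 2.1]; [Figueroa1995, §2–3]); harmful double rounding
of underflowing products is classical for equal precisions ([ShudoMuraoka2000, §3.2]).  NEW: the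
bookkeeping at a finer register quantum, incl. the gradual-underflow cells.  No hardware or
vendor claims.
-/

namespace Summit.Ventures.CertifiedArithmetic

open Literature.ComputerArithmetic.FloatingPoint
open Literature.ComputerArithmetic.FloatingPoint.Format
open Literature.ComputerArithmetic.FloatingPoint.MiniFloat

/-! ## §1 The normal cell -/

/-- THE WINDOW ON A NORMAL CELL at a finer register quantum (pointwise): `L_φ = L_ψ + d`,
`x = (c·2^t + r)·2^(k+1) q / 2^t` (`t ≥ 1`, `r < 2^t`, `2^m ≤ c < 2^(m+1)`, `(c+1)·2^(k+1) ≤ M_φ`),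
the register holding every multiple of `2^w q_ψ` on the cell (`(c+1)·2^(k+1+d) ≤ 2^(m_ψ+1+w)`,
`≤ M_ψ`), that being its spacing there if `w ≥ 1` (`2^(m_ψ+w) ≤ c·2^(k+1+d)`), `w ≤ k + d`,
`w + t = k + d + 2 + g`: a slip forces
`(c even ∧ 2^(t-1) < r ∧ (r < 2^(t-1) + 2^g ∨ (w + 1 ≤ k + d ∧ r = 2^(t-1) + 2^g))) ∨
 (c odd ∧ r < 2^(t-1) ∧ (2^(t-1) < r + 2^g ∨ (w + 1 ≤ k + d ∧ r + 2^g = 2^(t-1))))`.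
(`d = 0` is `sameQ_coarse_window_of_roundNE_roundNE_ne`.) [this packet] -/
theorem fine_normal_window_of_roundNE_roundNE_ne {φ ψ : Format} {d : ℕ}
    (hd : φ.qexp = ψ.qexp + d) (h1 : 1 ≤ φ.manBits) (h1ψ : 1 ≤ ψ.manBits)
    {c r t k w g : ℕ} (ht : 1 ≤ t) (hw : w ≤ k + d) (hg : w + t = k + d + 2 + g)
    (hr : r < 2 ^ t) (hclo : 2 ^ φ.manBits ≤ c) (hchi : c < 2 ^ (φ.manBits + 1))
    (hcM : (c + 1) * 2 ^ (k + 1) ≤ φ.maxScaled)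
    (hψm : (c + 1) * 2 ^ (k + 1 + d) ≤ 2 ^ (ψ.manBits + 1 + w))
    (hψM : (c + 1) * 2 ^ (k + 1 + d) ≤ ψ.maxScaled)
    (hψe : 1 ≤ w → 2 ^ (ψ.manBits + w) ≤ c * 2 ^ (k + 1 + d))
    (hne : (roundNE φ (roundNE ψ (((c * 2 ^ t + r : ℕ) : ℚ)
        * φ.quantum * 2 ^ (k + 1) / 2 ^ t)).toRat).toRat
      ≠ (roundNE φ (((c * 2 ^ t + r : ℕ) : ℚ) * φ.quantum * 2 ^ (k + 1) / 2 ^ t)).toRat) :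
    (c % 2 = 0 ∧ 2 ^ (t - 1) < r ∧
        (r < 2 ^ (t - 1) + 2 ^ g ∨ (w + 1 ≤ k + d ∧ r = 2 ^ (t - 1) + 2 ^ g))) ∨
      (c % 2 = 1 ∧ r < 2 ^ (t - 1) ∧
        (2 ^ (t - 1) < r + 2 ^ g ∨ (w + 1 ≤ k + d ∧ r + 2 ^ g = 2 ^ (t - 1)))) := by
  have hq0 := φ.quantum_pos
  have hq1 := ψ.quantum_pos
  have hQ : φ.quantum = 2 ^ d * ψ.quantum := by
    rw [quantum_eq_two_pow_mul (φ := φ) (ψ := ψ) (by omega),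
      show (φ.qexp - ψ.qexp).toNat = d by omega]
  obtain ⟨a, ha⟩ : ∃ a, k + d = w + a := ⟨k + d - w, by omega⟩
  obtain rfl : t = a + g + 2 := by omega
  rw [show a + g + 2 - 1 = a + g + 1 by omega]
  -- the unit `s` = the last bit of `x`; `B`, `H`, `S` = low corner, half cell, register grid
  set s : ℚ := φ.quantum * 2 ^ (k + 1) / 2 ^ (a + g + 2) with hs
  have hs0 : 0 < s := by positivity
  set x : ℚ := ((c * 2 ^ (a + g + 2) + r : ℕ) : ℚ) * φ.quantum * 2 ^ (k + 1)
    / 2 ^ (a + g + 2) with hx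
  set B : ℚ := ((c * 2 ^ (k + 1) : ℕ) : ℚ) * φ.quantum with hB
  set H : ℚ := (2 : ℚ) ^ k * φ.quantum with hH
  set S : ℚ := (2 : ℚ) ^ w * ψ.quantum with hSd
  have hH0 : 0 < H := by positivity
  have key : (2 : ℚ) ^ d * 2 ^ (k + 1) = 2 ^ w * 2 ^ (a + 1) := by
    rw [← pow_add, ← pow_add]; congr 1; omega
  have key' : (2 : ℚ) ^ k * 2 ^ d = 2 ^ (w + a) := by
    rw [show w + a = k + d by omega, pow_add (2 : ℚ) k d]
  have hqk : φ.quantum * 2 ^ (k + 1) = ψ.quantum * (2 ^ w * 2 ^ (a + 1)) := by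
    rw [hQ, mul_assoc, mul_comm ψ.quantum, ← mul_assoc, key]; ring
  have hHs : H = 2 ^ (a + g + 1) * s := by rw [hH, hs]; field_simp; ring
  have hSs : S = 2 * (2 ^ g * s) := by
    rw [hSd, hs, hqk]; field_simp; ring
  have hxs : x = B + (r : ℚ) * s := by rw [hx, hB, hs]; push_cast; field_simp; try ring
  have hμ : (((2 * c + 1) * 2 ^ k : ℕ) : ℚ) * φ.quantum = B + H := by
    rw [hB, hH]; push_cast; ring
  have hV' : (((c + 1) * 2 ^ (k + 1) : ℕ) : ℚ) * φ.quantum = B + 2 * H := by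
    rw [hB, hH]; push_cast; ring
  rw [hxs] at hne
  -- the register grid: every multiple of `2^w q_ψ` on the cell
  have hψpt : ∀ i : ℕ, i ≤ 2 ^ (a + 1) → ∃ z : MiniFloat ψ, z.toRat = B + (i : ℚ) * S := by
    intro i hi
    have hpow : 2 ^ (k + 1 + d) = 2 ^ (a + 1) * 2 ^ w := by rw [← pow_add]; congr 1; omega
    have hn : (c * 2 ^ (a + 1) + i) * 2 ^ w ≤ (c + 1) * 2 ^ (k + 1 + d) := by
      rw [hpow, ← mul_assoc]
      exact Nat.mul_le_mul_right _ (by nlinarith)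
    obtain ⟨z, hz⟩ := exists_toRat_eq_natMul (representable_of_pow_dvd (φ := ψ) (g := w)
      (n := (c * 2 ^ (a + 1) + i) * 2 ^ w) ⟨c * 2 ^ (a + 1) + i, by ring⟩ (le_trans hn hψm)
      (le_trans hn hψM))
    refine ⟨z, ?_⟩
    rw [hz, hB, hSd]; push_cast
    linear_combination (-(c : ℚ)) * hqk
  -- `fl_φ` on the cell: the gap lemmas
  have hlow : ∀ y : ℚ, B ≤ y → y < B + H → (roundNE φ y).toRat = B := by
    intro y hy1 hy2
    rcases eq_or_lt_of_le hy1 with hy | hy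
    · obtain ⟨v, hv⟩ := exists_toRat_eq_natMul
        ((representable_gmid (φ := φ) (t := c) (k := k) hchi hcM).1)
      rw [← hy, hB, ← hv, toRat_roundNE_toRat]
    · have hδ0 : 0 < (((2 * c + 1) * 2 ^ k : ℕ) : ℚ) * φ.quantum - y := by rw [hμ]; linarith
      have hδ : (((2 * c + 1) * 2 ^ k : ℕ) : ℚ) * φ.quantum - y < 2 ^ k * φ.quantum := by
        rw [hμ]; linarith
      have ey : y = (((2 * c + 1) * 2 ^ k : ℕ) : ℚ) * φ.quantum
          - ((((2 * c + 1) * 2 ^ k : ℕ) : ℚ) * φ.quantum - y) := by ring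
      rw [ey, toRat_roundNE_below_gmid hclo hchi hcM hδ0 hδ]
  have hhigh : ∀ y : ℚ, B + H < y → y ≤ B + 2 * H → (roundNE φ y).toRat = B + 2 * H := by
    intro y hy1 hy2
    rcases eq_or_lt_of_le hy2 with hy | hy
    · obtain ⟨v, hv⟩ := exists_toRat_eq_natMul
        ((representable_gmid (φ := φ) (t := c) (k := k) hchi hcM).2)
      rw [hy, ← hV', ← hv, toRat_roundNE_toRat]
    · have hδ0 : 0 < y - (((2 * c + 1) * 2 ^ k : ℕ) : ℚ) * φ.quantum := by rw [hμ]; linarith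
      have hδ : y - (((2 * c + 1) * 2 ^ k : ℕ) : ℚ) * φ.quantum < 2 ^ k * φ.quantum := by
        rw [hμ]; linarith
      have ey : y = (((2 * c + 1) * 2 ^ k : ℕ) : ℚ) * φ.quantum
          + (y - (((2 * c + 1) * 2 ^ k : ℕ) : ℚ) * φ.quantum) := by ring
      rw [ey, toRat_roundNE_above_gmid hclo hchi hcM hδ0 hδ, hV']
  have hmidE : c % 2 = 0 → (roundNE φ (B + H)).toRat = B := fun hc => by
    have := toRat_roundNE_gmid (k := k) h1 (Nat.even_iff.mpr hc) hclo hchi hcM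
    rwa [hμ] at this
  have hmidO : c % 2 = 1 → (roundNE φ (B + H)).toRat = B + 2 * H := fun hc => by
    have := toRat_roundNE_gmid_odd (k := k) h1 (Nat.odd_iff.mpr hc) hclo hchi hcM
    rwa [hμ, hV'] at this
  have hmid : (roundNE φ (B + H)).toRat = B ∨ (roundNE φ (B + H)).toRat = B + 2 * H := by
    rcases Nat.mod_two_eq_zero_or_one c with hc | hc
    · exact Or.inl (hmidE hc)
    · exact Or.inr (hmidO hc)
  -- the tie flag: `μ = (2c+1)·2^(w+a) q_ψ` with an even significand forces `a ≥ 1`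
  have hT : ∀ z : MiniFloat ψ, z.toRat = B + H → 2 ∣ z.man → w + 1 ≤ k + d := by
    intro z heq hev
    have heqψ : z.toRat = (((2 * c + 1) * 2 ^ (w + a) : ℕ) : ℚ) * ψ.quantum := by
      rw [heq, ← hμ, hQ]; push_cast; rw [← key']; ring
    rw [two_dvd_man_iff h1ψ, scaledMag_eq_of_toRat_eq heqψ] at hev
    by_contra ha0
    obtain rfl : a = 0 := by omega
    simp only [add_zero] at hev heqψ
    have h3 : 2 ^ (w + 1) ∣ (2 * c + 1) * 2 ^ w := by
      rcases Nat.eq_zero_or_pos w with hw0 | hw1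
      · subst hw0
        obtain ⟨y, hy⟩ := hev
        exact ⟨2 ^ (z.expCode - 1) * y, by rw [hy]; ring⟩
      · have hle : 2 ^ (ψ.manBits + 1 + (w - 1)) ≤ z.scaledMag := by
          rw [scaledMag_eq_of_toRat_eq heqψ, show ψ.manBits + 1 + (w - 1) = ψ.manBits + w by omega]
          calc 2 ^ (ψ.manBits + w) ≤ c * 2 ^ (k + 1 + d) := hψe hw1
            _ = c * 2 ^ (w + 1) := by rw [show k + 1 + d = w + 1 by omega]
            _ ≤ (2 * c + 1) * 2 ^ w := by
                rw [pow_succ]; nlinarith [Nat.one_le_two_pow (n := w)]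
        have hE := succ_le_ulpExp_of_le_scaledMag hle
        obtain ⟨j, hj⟩ := Nat.exists_eq_add_of_le (show w ≤ z.expCode - 1 by omega)
        refine dvd_trans ⟨2 ^ j, ?_⟩ hev
        rw [hj, pow_add, pow_succ]; ring
    obtain ⟨y, hy⟩ := h3
    have h4 : 2 ^ w * (2 * c + 1) = 2 ^ w * (2 * y) := by
      rw [mul_comm (2 ^ w), hy, pow_succ]; ring
    have h5 := Nat.eq_of_mul_eq_mul_left (by positivity) h4
    omega
  have hwin := twoGrid_window_of_roundNE_roundNE_ne h1ψ hs0 hHs hSs hr hψpt hlow hhigh hmid hT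
    hne
  rcases hwin with ⟨hm0, h2, h3⟩ | ⟨hm1, h2, h3⟩
  · refine Or.inl ⟨?_, h2, h3⟩
    by_contra hc
    have := hmidO (by omega)
    rw [hm0] at this; linarith
  · refine Or.inr ⟨?_, h2, h3⟩
    by_contra hc
    have := hmidE (by omega)
    rw [hm1] at this; linarith

/-! ## §2 A low cell `[c, c+1]·q`, `c ≥ 1` -/

/-- THE WINDOW ON A LOW CELL at a finer register quantum (pointwise): `L_φ = L_ψ + d`,
`x = (c·2^u + r)·q / 2^u` (`u ≥ 1`, `r < 2^u`, `1 ≤ c`, `c + 1 ≤ 2^(m+1)`, `c + 1 ≤ M_φ`: the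
cell `[c, c+1]·q` of the gradual-underflow zone of `φ`), the register holding every multiple of
`2^w q_ψ` on the cell (`(c+1)·2^d ≤ 2^(m_ψ+1+w)`, `≤ M_ψ`), that being its spacing there if
`w ≥ 1` (`2^(m_ψ+w) ≤ c·2^d`), `w + 1 ≤ d`, `w + u = d + 1 + g`: a slip forces
`(c even ∧ 2^(u-1) < r ∧ (r < 2^(u-1) + 2^g ∨ (w + 2 ≤ d ∧ r = 2^(u-1) + 2^g))) ∨
 (c odd ∧ r < 2^(u-1) ∧ (2^(u-1) < r + 2^g ∨ (w + 2 ≤ d ∧ r + 2^g = 2^(u-1))))`.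
[this packet] -/
theorem fine_low_window_of_roundNE_roundNE_ne {φ ψ : Format} {d : ℕ}
    (hd : φ.qexp = ψ.qexp + d) (h1 : 1 ≤ φ.manBits) (h1ψ : 1 ≤ ψ.manBits)
    {c r u w g : ℕ} (hu : 1 ≤ u) (hw : w + 1 ≤ d) (hg : w + u = d + 1 + g) (hr : r < 2 ^ u)
    (hc1 : 1 ≤ c) (hcm : c + 1 ≤ 2 ^ (φ.manBits + 1)) (hcM : c + 1 ≤ φ.maxScaled)
    (hψm : (c + 1) * 2 ^ d ≤ 2 ^ (ψ.manBits + 1 + w)) (hψM : (c + 1) * 2 ^ d ≤ ψ.maxScaled)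
    (hψe : 1 ≤ w → 2 ^ (ψ.manBits + w) ≤ c * 2 ^ d)
    (hne : (roundNE φ (roundNE ψ (((c * 2 ^ u + r : ℕ) : ℚ) * φ.quantum / 2 ^ u)).toRat).toRat
      ≠ (roundNE φ (((c * 2 ^ u + r : ℕ) : ℚ) * φ.quantum / 2 ^ u)).toRat) :
    (c % 2 = 0 ∧ 2 ^ (u - 1) < r ∧
        (r < 2 ^ (u - 1) + 2 ^ g ∨ (w + 2 ≤ d ∧ r = 2 ^ (u - 1) + 2 ^ g))) ∨
      (c % 2 = 1 ∧ r < 2 ^ (u - 1) ∧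
        (2 ^ (u - 1) < r + 2 ^ g ∨ (w + 2 ≤ d ∧ r + 2 ^ g = 2 ^ (u - 1)))) := by
  have hq0 := φ.quantum_pos
  have hq1 := ψ.quantum_pos
  have hQ : φ.quantum = 2 ^ d * ψ.quantum := by
    rw [quantum_eq_two_pow_mul (φ := φ) (ψ := ψ) (by omega),
      show (φ.qexp - ψ.qexp).toNat = d by omega]
  obtain ⟨a, ha⟩ : ∃ a, d = w + a + 1 := ⟨d - w - 1, by omega⟩
  obtain rfl : u = a + g + 2 := by omega
  rw [show a + g + 2 - 1 = a + g + 1 by omega]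
  set s : ℚ := φ.quantum / 2 ^ (a + g + 2) with hs
  have hs0 : 0 < s := by positivity
  set x : ℚ := ((c * 2 ^ (a + g + 2) + r : ℕ) : ℚ) * φ.quantum / 2 ^ (a + g + 2) with hx
  set B : ℚ := (c : ℚ) * φ.quantum with hB
  set H : ℚ := φ.quantum / 2 with hH
  set S : ℚ := (2 : ℚ) ^ w * ψ.quantum with hSd
  have hH0 : 0 < H := by positivity
  have key : (2 : ℚ) ^ d = 2 ^ w * 2 ^ (a + 1) := by
    rw [show d = w + (a + 1) by omega, pow_add (2 : ℚ) w (a + 1)]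
  have hqk : φ.quantum = ψ.quantum * (2 ^ w * 2 ^ (a + 1)) := by rw [hQ, key]; ring
  have hHs : H = 2 ^ (a + g + 1) * s := by rw [hH, hs]; field_simp; ring
  have hSs : S = 2 * (2 ^ g * s) := by rw [hSd, hs, hqk]; field_simp; ring
  have hxs : x = B + (r : ℚ) * s := by rw [hx, hB, hs]; push_cast; field_simp; try ring
  have hμ : B + H = ((2 * c + 1 : ℕ) : ℚ) / 2 * φ.quantum := by rw [hB, hH]; push_cast; ring
  have hV' : B + 2 * H = ((c + 1 : ℕ) : ℚ) * φ.quantum := by rw [hB, hH]; push_cast; ring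
  rw [hxs] at hne
  -- the register grid
  have hψpt : ∀ i : ℕ, i ≤ 2 ^ (a + 1) → ∃ z : MiniFloat ψ, z.toRat = B + (i : ℚ) * S := by
    intro i hi
    have hpow : 2 ^ d = 2 ^ (a + 1) * 2 ^ w := by
      rw [show d = (a + 1) + w by omega, pow_add 2 (a + 1) w]
    have hn : (c * 2 ^ (a + 1) + i) * 2 ^ w ≤ (c + 1) * 2 ^ d := by
      rw [hpow, ← mul_assoc]
      exact Nat.mul_le_mul_right _ (by nlinarith)
    obtain ⟨z, hz⟩ := exists_toRat_eq_natMul (representable_of_pow_dvd (φ := ψ) (g := w)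
      (n := (c * 2 ^ (a + 1) + i) * 2 ^ w) ⟨c * 2 ^ (a + 1) + i, by ring⟩ (le_trans hn hψm)
      (le_trans hn hψM))
    refine ⟨z, ?_⟩
    rw [hz, hB, hSd]; push_cast
    linear_combination (-(c : ℚ)) * hqk
  -- `fl_φ` on the cell: the nearest value within half a quantum, the half-integer at `μ`
  have hrepc : φ.Representable c := representable_of_le_pow (by omega) (by omega)
  have hrepc1 : φ.Representable (c + 1) := representable_of_le_pow hcm hcM
  have hlow : ∀ y : ℚ, B ≤ y → y < B + H → (roundNE φ y).toRat = B := by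
    intro y hy1 hy2
    have ey : y = (c : ℚ) * φ.quantum + (y - B) := by rw [hB]; ring
    rw [ey, hB]
    refine toRat_roundNE_natMul_add_small hrepc ?_
    rw [abs_of_nonneg (by linarith)]; linarith
  have hhigh : ∀ y : ℚ, B + H < y → y ≤ B + 2 * H → (roundNE φ y).toRat = B + 2 * H := by
    intro y hy1 hy2
    have ey : y = ((c + 1 : ℕ) : ℚ) * φ.quantum + (y - (B + 2 * H)) := by rw [← hV']; ring
    rw [ey, hV']
    refine toRat_roundNE_natMul_add_small hrepc1 ?_
    rw [abs_of_nonpos (by linarith)]; linarith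
  have h2pow : 2 ∣ 2 ^ (φ.manBits + 1) := ⟨2 ^ φ.manBits, by rw [pow_succ]; ring⟩
  have hmidE : c % 2 = 0 → (roundNE φ (B + H)).toRat = B := fun hc => by
    have := toRat_roundNE_half_of_even h1 (j := c) (Nat.even_iff.mpr hc) (by omega) hcM
    rwa [← hμ] at this
  have hmidO : c % 2 = 1 → (roundNE φ (B + H)).toRat = B + 2 * H := fun hc => by
    have := toRat_roundNE_half_of_odd_le h1 (j := c) (Nat.odd_iff.mpr hc) hcm hcM
    rwa [← hμ, ← hV'] at this
  have hmid : (roundNE φ (B + H)).toRat = B ∨ (roundNE φ (B + H)).toRat = B + 2 * H := by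
    rcases Nat.mod_two_eq_zero_or_one c with hc | hc
    · exact Or.inl (hmidE hc)
    · exact Or.inr (hmidO hc)
  -- the tie flag: `μ = (2c+1)·2^(w+a) q_ψ` with an even significand forces `a ≥ 1`
  have hT : ∀ z : MiniFloat ψ, z.toRat = B + H → 2 ∣ z.man → w + 2 ≤ d := by
    intro z heq hev
    have heqψ : z.toRat = (((2 * c + 1) * 2 ^ (w + a) : ℕ) : ℚ) * ψ.quantum := by
      rw [heq, hμ, hqk]; push_cast; ring
    rw [two_dvd_man_iff h1ψ, scaledMag_eq_of_toRat_eq heqψ] at hev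
    by_contra ha0
    obtain rfl : a = 0 := by omega
    simp only [add_zero] at hev heqψ
    have h3 : 2 ^ (w + 1) ∣ (2 * c + 1) * 2 ^ w := by
      rcases Nat.eq_zero_or_pos w with hw0 | hw1
      · subst hw0
        obtain ⟨y, hy⟩ := hev
        exact ⟨2 ^ (z.expCode - 1) * y, by rw [hy]; ring⟩
      · have hle : 2 ^ (ψ.manBits + 1 + (w - 1)) ≤ z.scaledMag := by
          rw [scaledMag_eq_of_toRat_eq heqψ, show ψ.manBits + 1 + (w - 1) = ψ.manBits + w by omega]
          calc 2 ^ (ψ.manBits + w) ≤ c * 2 ^ d := hψe hw1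
            _ = c * 2 ^ (w + 1) := by rw [show d = w + 1 by omega]
            _ ≤ (2 * c + 1) * 2 ^ w := by
                rw [pow_succ]; nlinarith [Nat.one_le_two_pow (n := w)]
        have hE := succ_le_ulpExp_of_le_scaledMag hle
        obtain ⟨j, hj⟩ := Nat.exists_eq_add_of_le (show w ≤ z.expCode - 1 by omega)
        refine dvd_trans ⟨2 ^ j, ?_⟩ hev
        rw [hj, pow_add, pow_succ]; ring
    obtain ⟨y, hy⟩ := h3
    have h4 : 2 ^ w * (2 * c + 1) = 2 ^ w * (2 * y) := by
      rw [mul_comm (2 ^ w), hy, pow_succ]; ring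
    have h5 := Nat.eq_of_mul_eq_mul_left (by positivity) h4
    omega
  have hwin := twoGrid_window_of_roundNE_roundNE_ne h1ψ hs0 hHs hSs hr hψpt hlow hhigh hmid hT
    hne
  rcases hwin with ⟨hm0, h2, h3⟩ | ⟨hm1, h2, h3⟩
  · refine Or.inl ⟨?_, h2, h3⟩
    by_contra hc
    have := hmidO (by omega)
    rw [hm0] at this; linarith
  · refine Or.inr ⟨?_, h2, h3⟩
    by_contra hc
    have := hmidE (by omega)
    rw [hm1] at this; linarith

/-! ## §3 The bottom cell `[0, q]` -/

/-- THE WINDOW ON THE BOTTOM CELL at a finer register quantum (pointwise): `L_φ = L_ψ + d`,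
`x = r·q / 2^u` (`r < 2^u`), `1 ≤ M_φ`, the register holding every multiple of `2^w q_ψ` on
`[0, q]` (`2^d ≤ 2^(m_ψ+1+w)`, `2^d ≤ M_ψ`), `w + 1 ≤ d`, `w + u = d + 1 + g`: a slip forces
`2^(u-1) < r ≤ 2^(u-1) + 2^g` (`fl_φ (q/2) = 0`: the tie of `ψ` at the boundary always counts).
[this packet] -/
theorem fine_bottom_window_of_roundNE_roundNE_ne {φ ψ : Format} {d : ℕ}
    (hd : φ.qexp = ψ.qexp + d) (h1 : 1 ≤ φ.manBits) (h1ψ : 1 ≤ ψ.manBits)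
    {r u w g : ℕ} (hw : w + 1 ≤ d) (hg : w + u = d + 1 + g) (hr : r < 2 ^ u)
    (h1M : 1 ≤ φ.maxScaled) (hψm : 2 ^ d ≤ 2 ^ (ψ.manBits + 1 + w))
    (hψM : 2 ^ d ≤ ψ.maxScaled)
    (hne : (roundNE φ (roundNE ψ ((r : ℚ) * φ.quantum / 2 ^ u)).toRat).toRat
      ≠ (roundNE φ ((r : ℚ) * φ.quantum / 2 ^ u)).toRat) :
    2 ^ (u - 1) < r ∧ r ≤ 2 ^ (u - 1) + 2 ^ g := by
  have hq0 := φ.quantum_pos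
  have hq1 := ψ.quantum_pos
  have hQ : φ.quantum = 2 ^ d * ψ.quantum := by
    rw [quantum_eq_two_pow_mul (φ := φ) (ψ := ψ) (by omega),
      show (φ.qexp - ψ.qexp).toNat = d by omega]
  obtain ⟨a, ha⟩ : ∃ a, d = w + a + 1 := ⟨d - w - 1, by omega⟩
  obtain rfl : u = a + g + 2 := by omega
  rw [show a + g + 2 - 1 = a + g + 1 by omega]
  set s : ℚ := φ.quantum / 2 ^ (a + g + 2) with hs
  have hs0 : 0 < s := by positivity
  set H : ℚ := φ.quantum / 2 with hH
  set S : ℚ := (2 : ℚ) ^ w * ψ.quantum with hSd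
  have hH0 : 0 < H := by positivity
  have key : (2 : ℚ) ^ d = 2 ^ w * 2 ^ (a + 1) := by
    rw [show d = w + (a + 1) by omega, pow_add (2 : ℚ) w (a + 1)]
  have hqk : φ.quantum = ψ.quantum * (2 ^ w * 2 ^ (a + 1)) := by rw [hQ, key]; ring
  have hHs : H = 2 ^ (a + g + 1) * s := by rw [hH, hs]; field_simp; ring
  have hSs : S = 2 * (2 ^ g * s) := by rw [hSd, hs, hqk]; field_simp; ring
  have hxs : (r : ℚ) * φ.quantum / 2 ^ (a + g + 2) = 0 + (r : ℚ) * s := by rw [hs]; ring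
  rw [hxs] at hne
  have hψpt : ∀ i : ℕ, i ≤ 2 ^ (a + 1) → ∃ z : MiniFloat ψ, z.toRat = 0 + (i : ℚ) * S := by
    intro i hi
    have hpow : 2 ^ d = 2 ^ (a + 1) * 2 ^ w := by
      rw [show d = (a + 1) + w by omega, pow_add 2 (a + 1) w]
    have hn : i * 2 ^ w ≤ 2 ^ d := by rw [hpow]; exact Nat.mul_le_mul_right _ hi
    obtain ⟨z, hz⟩ := exists_toRat_eq_natMul (representable_of_pow_dvd (φ := ψ) (g := w)
      (n := i * 2 ^ w) ⟨i, by ring⟩ (le_trans hn hψm) (le_trans hn hψM))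
    exact ⟨z, by rw [hz, hSd]; push_cast; ring⟩
  have hzero : ∀ y : ℚ, 0 ≤ y → y ≤ H → (roundNE φ y).toRat = 0 := fun y hy1 hy2 =>
    toRat_roundNE_eq_zero_of_abs_le_half h1 (by rw [abs_of_nonneg hy1]; exact hy2)
  have hlow : ∀ y : ℚ, 0 ≤ y → y < 0 + H → (roundNE φ y).toRat = 0 := fun y hy1 hy2 =>
    hzero y hy1 (by linarith)
  have h2H : (0 : ℚ) + 2 * H = ((1 : ℕ) : ℚ) * φ.quantum := by rw [hH]; push_cast; ring
  have hrep1 : φ.Representable 1 :=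
    representable_of_le_pow (le_trans h1 (by
      have := Nat.lt_two_pow_self (n := φ.manBits + 1); omega)) h1M
  have hhigh : ∀ y : ℚ, 0 + H < y → y ≤ 0 + 2 * H → (roundNE φ y).toRat = 0 + 2 * H := by
    intro y hy1 hy2
    have ey : y = ((1 : ℕ) : ℚ) * φ.quantum + (y - (0 + 2 * H)) := by rw [← h2H]; ring
    rw [ey, h2H]
    refine toRat_roundNE_natMul_add_small hrep1 ?_
    rw [abs_of_nonpos (by linarith)]; linarith
  have hmid0 : (roundNE φ (0 + H)).toRat = 0 := hzero _ (by linarith) (by linarith)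
  have hwin := twoGrid_window_of_roundNE_roundNE_ne (T := True) h1ψ hs0 hHs hSs hr hψpt hlow
    hhigh (Or.inl hmid0) (fun _ _ _ => trivial) hne
  rcases hwin with ⟨-, h2, h3⟩ | ⟨hm1, -, -⟩
  · exact ⟨h2, by rcases h3 with h | ⟨-, h⟩ <;> omega⟩
  · rw [hmid0] at hm1; linarith

end Summit.Ventures.CertifiedArithmetic
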